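import Literature.NumberTheory.Transcendental.KZLogCalculusProofs
import Summits.KontsevichZagierPeriods.KontsevichZagierPeriods.Theses.DefinableMoves

/-!
# Route DefinableMoves — `NullIffEmptyInterior` (settles item stmt-KontsevichZagierPeriods-4092)

Support item of route `DefinableMoves` (problem `KontsevichZagierPeriods`): for a `ℚ`-semialgebraic
`A ⊆ ℝⁿ`, `volume A = 0 ↔ interior A = ∅`. This is what makes the side condition
`volume (σ₁ ∩ σ₂) = 0` of the scissors move (`domainAddRel`) a first-order condition on the real
data of a chain template (used by the crux `Transfer`).

Proof. (⇒) holds for every subset of `ℝⁿ`: `interior A ⊆ A` is a null open set, and Lebesgue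
measure on `Fin n → ℝ` is positive on non-empty open sets (`IsOpen.measure_eq_zero_iff`).
(⇐) is the tree lemma `Literature.NumberTheory.Transcendental.KZ.volume_eq_zero_of_interior_eq_empty`
(a `ℚ`-semialgebraic set with empty interior is covered by finitely many zero sets of non-zero
polynomials — `IsSemialgebraic.subset_interior_union` — each Lebesgue-null,
`volume_setOf_aeval_eq_zero`). The degenerate dimension `n = 0` needs no separate treatment
(`A = univ`: both sides false, the point has volume `1`; `A = ∅`: both sides true).

Sources: J. Bochnak, M. Coste, M.-F. Roy, *Real Algebraic Geometry* (1998), §2.8 (a semialgebraic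
set has empty interior iff it lies in a proper algebraic subset); R. Caron, T. Traynor, *The zero
set of a polynomial* (2005). Deliberately NOT here: the version over other coefficient rings
`k → ℝ` (the item is filed over `ℚ`).
-/

namespace Summit.KontsevichZagierPeriods.DefinableMoves

open MeasureTheory Set

/-- Settles stmt-KontsevichZagierPeriods-4092 (`NullIffEmptyInterior`, route `DefinableMoves`):
for a `ℚ`-semialgebraic `A ⊆ ℝⁿ`, `volume A = 0 ↔ interior A = ∅`. Forward: a null open set
(`interior A`) is empty since Lebesgue measure is positive on non-empty open sets; backward: the
tree lemma `KZ.volume_eq_zero_of_interior_eq_empty` (finitely many null zero sets of non-zero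
polynomials cover a semialgebraic set with empty interior). [Bochnak–Coste–Roy 1998, §2.8]
[folklore] -/
theorem nullIffEmptyInterior_proof :
    Summit.KontsevichZagierPeriods.KontsevichZagierPeriods.Theses.DefinableMoves.NullIffEmptyInterior := by
  intro n A hA
  constructor
  · intro h0
    exact (isOpen_interior.measure_eq_zero_iff volume).mp
      (measure_mono_null interior_subset h0)
  · exact Literature.NumberTheory.Transcendental.KZ.volume_eq_zero_of_interior_eq_empty hA

end Summit.KontsevichZagierPeriods.DefinableMoves
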